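import Literature.Analysis.ODE.CodeListSimplification
import Literature.Analysis.ODE.ElementaryFieldMeanValueCertificate
import HarnessLib

/-!
# The fast `C¹` step certificate for elementary fields (constant-folded Jacobian code lists)

Trunk T-ANA (Analysis/ODE); namespace `Literature.Analysis.ODE`.

The `C¹` step certificate `EVarStepCert` of `ElementaryFieldVariationalCertificate.lean` encloses the
Jacobians `DΦⱼ(W)` of the flow Taylor coefficient maps by the natural interval extensions of the
derived code lists `pderiv l (taylorExpr F j i)` — trees of size `(2n)ʲ·|f|`, the dominant cost of
the kernel replay of a `C¹`-Lohner step.  This file re-runs the SAME certificate data through the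
constant-folded code lists `jacExprS F j i l` of `CodeListSimplification.lean`:

* §1 `FExpr.taylorExprS` — the Lie–Taylor recursion with the smart constructors — and its meaning
  on the natural domain `Ω`: `eval_taylorExprS : ⟦taylorExprS F j i⟧(x) = (Φⱼ(x))ᵢ` (the induction
  of `eval_taylorExpr`), `jacExprS`, `smoothTaylorFDeriv_apply_single_eqS`,
  `smoothTaylorFDeriv_mem_evalBoxS` (`D_l (Φⱼ)ᵢ (B) ∋` the Jacobian entry);
* §2 `EVarStepCert.checkS` / `varCoeffBoxS` / `varRemFactorS` / `varRemBoxS` / `varEndBoxS`: the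
  decidable `C¹` test of `EVarStepCert.check` with `jacExprS` in place of `pderiv ∘ taylorExpr`
  (state half `toE.check` unchanged), and the soundness consequences the downstream mean value /
  doubleton layers consume, with the SAME statements as for `check`: `checkS_spec`,
  `varCoeffBoxS_mem`, `varRemFactorS_mem`, `hasFDerivWithinAt_flowS`, `hasFDerivWithinAt_flow_stepS`
  (`D_xφ(h,·)` on `W` has entries in `J1 := varEndBoxS`) — every analytic step is the tree's
  `hasFDerivWithinAt_flow_intervalTest_smoothOn_local`, only the box hypotheses are discharged by
  the folded code lists.

Design.  Nothing landed is modified: the fast checker is a second decidable test on the same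
certificate structures with its own soundness theorems; a certificate may pass one test and fail
the other (different code lists round differently), soundness holds for each.  The mean value
form and the doubleton hand-over on top of `checkS` are `ElementaryFieldDoubletonStepFast.lean`,
the chain and the packaged verifier `ElementaryFieldDoubletonChainCertificateFast.lean`.

## References

* I. Walawska, D. Wilczak, Appl. Math. Comput. 291 (2016), §1.2, §2.1 (C¹ high-order enclosure),
  §2.2 Lemma 2. [WalawskaWilczak2016]
* P. Zgliczyński, *C¹-Lohner algorithm*, Found. Comput. Math. 2 (2002), §3. [Zgliczynski2002C1Lohner]
* R. E. Moore, *Methods and Applications of Interval Analysis*, SIAM 1979: §3.4 (3.13)–(3.19) and the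
  note after (3.19), §4.3 (4.19), (4.21), §8.1 (8.10), (8.13). [Moore1979]
* E. Hairer, C. Lubich, G. Wanner, *Geometric Numerical Integration*, Springer 2002, §III.5.1
  eqs. (5.6), (5.8). [HairerWannerLubich2002]
* A. Neumaier, *Interval Methods for Systems of Equations*, Cambridge UP 1990, §3.1 Prop. 3.1.2,
  Cor. 5.1.5. [Neumaier1991]
* N. S. Nedialkov, K. R. Jackson, J. D. Pryce, Reliable Computing 7 (2001), §3. [NedialkovJacksonPryce2001]
* R. E. Moore, *Interval Analysis*, Prentice-Hall 1966, Theorem 3.1. [Moore1966]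
-/

noncomputable section

open Set NonemptyInterval TopologicalSpace Matrix
open scoped ContDiff
open Literature.Analysis.ValidatedNumerics Literature.Analysis.ValidatedNumerics.ITaylor

namespace Literature.Analysis.ODE

namespace FExpr

variable {n : ℕ}

/-! ### §1. The constant-folded Lie–Taylor recursion and its meaning on the natural domain -/

/-- The constant-folded code list `t₀ + (t₁ + ⋯ + (t_{n-1} + 0))` of a sum over the state indices.
[cite: Moore1979, §3.4 procedure step 1] -/
def sSumE (t : Fin n → FExpr n) : FExpr n :=
  (List.finRange n).foldr (fun l acc => sAdd (t l) acc) (const 0)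

/-- [folklore] -/
private theorem eval_foldr_sAdd (t : Fin n → FExpr n) (x : Fin n → ℝ) (L : List (Fin n)) :
    (L.foldr (fun l acc => sAdd (t l) acc) (const 0)).eval x =
      (L.map fun l => (t l).eval x).sum := by
  induction L with
  | nil => simp [eval]
  | cons l L ih => rw [List.foldr_cons, List.map_cons, List.sum_cons, ← ih, eval_sAdd]

/-- [folklore] -/
private theorem dom_foldr_sAdd {t : Fin n → FExpr n} {x : Fin n → ℝ} (h : ∀ l, (t l).dom x)
    (L : List (Fin n)) : (L.foldr (fun l acc => sAdd (t l) acc) (const 0)).dom x := by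
  induction L with
  | nil => trivial
  | cons l L ih => exact dom_sAdd (h l) ih

/-- The constant-folded sum code list denotes the sum. [cite: Moore1979, §3.4 procedure step 1] -/
theorem eval_sSumE (t : Fin n → FExpr n) (x : Fin n → ℝ) :
    (sSumE t).eval x = ∑ l, (t l).eval x := by
  rw [Fin.sum_univ_def]
  exact eval_foldr_sAdd t x _

/-- The constant-folded sum code list is defined where its terms are.
[cite: Moore1979, §3.4 procedure step 1] -/
theorem dom_sSumE {t : Fin n → FExpr n} {x : Fin n → ℝ} (h : ∀ l, (t l).dom x) :
    (sSumE t).dom x :=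
  dom_foldr_sAdd h _

/-- **The constant-folded code lists of the flow Taylor coefficient maps**: the Lie–Taylor
recursion `(Φ₀)ᵢ = Xᵢ`, `(Φ_{j+1})ᵢ = (1/(j+1)) ∑_l f_l · ∂_l (Φⱼ)ᵢ` of `taylorExpr`, every line
formed with the smart constructors and the constant-folded derived code lists `pderivS`.
[cite: Moore1979, §3.4 eqs. (3.15), (3.17)] [cite: HairerWannerLubich2002, §III.5.1 eqs. (5.6), (5.8)]
[cite: Moore1979, §3.4 (note after eq. (3.19))] -/
def taylorExprS (F : Fin n → FExpr n) : ℕ → Fin n → FExpr n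
  | 0, i => var i
  | j + 1, i =>
    sSmul (1 / ((j : ℚ) + 1)) (sSumE fun l => sMul (F l) (pderivS l (taylorExprS F j i)))

/-- The constant-folded coefficient code lists are defined on the natural domain of the field.
[cite: Moore1979, §3.4 (last paragraph)] [cite: Moore1979, §4.3 eq. (4.21)] -/
theorem dom_taylorExprS (F : Fin n → FExpr n) {x : Fin n → ℝ} (hx : x ∈ domOpens F) :
    ∀ (j : ℕ) (i : Fin n), (taylorExprS F j i).dom x
  | 0, _ => trivial
  | j + 1, i => by
    show (sSmul (1 / ((j : ℚ) + 1))
      (sSumE fun l => sMul (F l) (pderivS l (taylorExprS F j i)))).dom x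
    exact dom_sSmul _ (dom_sSumE fun l =>
      dom_sMul (mem_domOpens.mp hx l) (dom_pderivS l _ (dom_taylorExprS F hx j i)))

/-- The derivative of the extension by zero of a function on the open set `Ω` that agrees there
with a globally defined one. [folklore] -/
private theorem fderiv_extendZero_eq_of_eqOn' {Ω : Opens (Fin n → ℝ)} {g : Ω → ℝ}
    {G : (Fin n → ℝ) → ℝ} (hgG : ∀ (y : Fin n → ℝ) (hy : y ∈ Ω), g ⟨y, hy⟩ = G y)
    {x : Fin n → ℝ} (hx : x ∈ Ω) : fderiv ℝ (extendZero Ω g) x = fderiv ℝ G x := by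
  refine Filter.EventuallyEq.fderiv_eq ?_
  filter_upwards [Ω.isOpen.mem_nhds hx] with y hy
  rw [extendZero_of_mem _ hy, hgG y hy]

/-- **The constant-folded coefficient code lists denote the flow Taylor coefficient maps**: on the
natural domain `Ω` of the field, `⟦taylorExprS F j i⟧(x) = (Φⱼ(x))ᵢ` — the induction of
`eval_taylorExpr` verbatim (Lie–Taylor recursion `Φⱼ'(x) f(x) = (j+1) Φ_{j+1}(x)`, columns of
`Φⱼ'` = derived code lists), the smart constructors denoting the plain operations (`eval_sSmul`,
`eval_sSumE`, `eval_sMul`, `eval_pderivS`). [cite: Moore1979, §3.4 eqs. (3.13), (3.15)]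
[cite: HairerWannerLubich2002, §III.5.1 eqs. (5.6), (5.8)] -/
theorem eval_taylorExprS (F : Fin n → FExpr n) :
    ∀ (j : ℕ) (i : Fin n) {x : Fin n → ℝ}, x ∈ domOpens F →
      (taylorExprS F j i).eval x = smoothTaylorMap (contDiffOn_fieldFun F) j x i
  | 0, i, x, _ => by rw [smoothTaylorMap_zero]; rfl
  | j + 1, i, x, hx => by
    have hrec := congr_fun (smoothTaylorFDeriv_apply_field (contDiffOn_fieldFun F) j hx) i
    simp only [Pi.smul_apply, smul_eq_mul, smoothTaylorFDeriv_apply] at hrec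
    have hfd : fderiv ℝ (extendZero (domOpens F) (flowCoeff (contDiffOn_fieldFun F) j i)) x =
        fderiv ℝ (taylorExprS F j i).eval x :=
      fderiv_extendZero_eq_of_eqOn' (fun y hy => by
        have h1 := congr_fun (smoothTaylorMap_of_mem (contDiffOn_fieldFun F) j hy) i
        rw [← h1]
        exact (eval_taylorExprS F j i hy).symm) hx
    rw [hfd, fderiv_apply_eq_sum_pderiv (taylorExprS F j i) (dom_taylorExprS F hx j i)] at hrec
    have hj : ((j : ℝ) + 1) ≠ 0 := by positivity
    show (sSmul (1 / ((j : ℚ) + 1))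
        (sSumE fun l => sMul (F l) (pderivS l (taylorExprS F j i)))).eval x = _
    rw [eval_sSmul, eval_sSumE]
    have hsum : ∑ l, (sMul (F l) (pderivS l (taylorExprS F j i))).eval x =
        ∑ k, fieldFun F x k * ((taylorExprS F j i).pderiv k).eval x := by
      refine Finset.sum_congr rfl fun l _ => ?_
      rw [eval_sMul, eval_pderivS]
      rfl
    rw [hsum, hrec]
    push_cast
    field_simp

/-- The flow coefficient `(Φⱼ)ᵢ ∈ C^∞(Ω)` is the interpreted constant-folded coefficient code list.
[cite: HairerWannerLubich2002, §III.5.1 eq. (5.8)] [cite: Moore1979, §3.4 eq. (3.13)] -/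
theorem flowCoeff_eq_eval_taylorExprS (F : Fin n → FExpr n) (j : ℕ) (i : Fin n)
    {y : Fin n → ℝ} (hy : y ∈ domOpens F) :
    flowCoeff (contDiffOn_fieldFun F) j i ⟨y, hy⟩ = (taylorExprS F j i).eval y := by
  have h1 := congr_fun (smoothTaylorMap_of_mem (contDiffOn_fieldFun F) j hy) i
  rw [← h1, eval_taylorExprS F j i hy]

/-- **The constant-folded Jacobian code lists**: `jacExprS F j i l := pderivS l (taylorExprS F j i)`,
the code list of the `(i, l)` entry of `DΦⱼ`. [cite: Moore1979, §4.3 eq. (4.21)]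
[cite: WalawskaWilczak2016, §2.1 (C¹ high-order enclosure)] -/
def jacExprS (F : Fin n → FExpr n) (j : ℕ) (i l : Fin n) : FExpr n :=
  pderivS l (taylorExprS F j i)

/-- **The entries of the Jacobian of the flow Taylor coefficient map are the constant-folded derived
code lists**: `(DΦⱼ(x) e_l)ᵢ = ⟦jacExprS F j i l⟧(x)` on the natural domain.
[cite: Moore1979, §4.3 eq. (4.21)] [cite: WalawskaWilczak2016, §2.1 (C¹ high-order enclosure)] -/
theorem smoothTaylorFDeriv_apply_single_eqS (F : Fin n → FExpr n) (j : ℕ) {x : Fin n → ℝ}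
    (hx : x ∈ domOpens F) (i l : Fin n) :
    smoothTaylorFDeriv (contDiffOn_fieldFun F) j x (Pi.single l 1) i =
      (jacExprS F j i l).eval x := by
  rw [jacExprS, eval_pderivS, smoothTaylorFDeriv_apply,
    fderiv_extendZero_eq_of_eqOn' (fun y hy => flowCoeff_eq_eval_taylorExprS F j i hy) hx,
    fderiv_eval_single _ l (dom_taylorExprS F hx j i)]

/-- **`D_l (Φⱼ)ᵢ (B)` by the constant-folded code list**: if the box `B` lies in the natural domain
of the field and the natural interval extension of `jacExprS F j i l` over `B` answers `D`, then
`D` encloses the Jacobian entry of the flow Taylor coefficient map on `B` — the drop-in replacement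
for `smoothTaylorFDeriv_mem_evalBox`. [cite: Moore1979, §4.3 eq. (4.21)] [cite: Moore1966, Theorem 3.1]
[cite: WalawskaWilczak2016, §2.1 (C¹ high-order enclosure)] -/
theorem smoothTaylorFDeriv_mem_evalBoxS {cfg : SeedCfg} {F : Fin n → FExpr n} {B : Fin n → Iv}
    (hB : boxSet (castBox B) ⊆ domOpens F) {j : ℕ} {i l : Fin n} {D : Iv}
    (hD : evalBox cfg (jacExprS F j i l) B = some D) {y : Fin n → ℝ}
    (hy : y ∈ boxSet (castBox B)) :
    smoothTaylorFDeriv (contDiffOn_fieldFun F) j y (Pi.single l 1) i ∈ D.ratCast ℝ := by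
  rw [smoothTaylorFDeriv_apply_single_eqS F j (hB hy) i l]
  exact (evalBox_sound hD hy).2

/-- All `n × n` entries pass a Boolean test. [folklore] -/
private def allEntriesS (p : Fin n → Fin n → Bool) : Bool :=
  (List.finRange n).all fun i => (List.finRange n).all fun l => p i l

/-- [folklore] -/
private theorem of_allEntriesS {p : Fin n → Fin n → Bool} (h : allEntriesS p = true) (i l : Fin n) :
    p i l = true :=
  List.all_eq_true.1 (List.all_eq_true.1 h i (List.mem_finRange i)) l (List.mem_finRange l)

end FExpr

open FExpr

variable {n : ℕ}

/-! ### §2. The fast `C¹` test and its soundness -/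

namespace EVarStepCert

variable (c : EVarStepCert n)

/-- The Jacobian coefficient matrices `EVⱼ(i,l) = ⟦jacExprS f j i l⟧(W) ∋ (DΦⱼ(x) e_l)ᵢ` by the
constant-folded code lists (junk `0` if the derived program gave up).
[cite: WalawskaWilczak2016, §2.1 (C¹ high-order enclosure)] [cite: Moore1979, §4.3 eq. (4.21)] -/
def varCoeffBoxS (j : ℕ) (i l : Fin n) : Iv :=
  (evalBox c.cfg (jacExprS c.field j i l) c.init).getD 0

/-- The Jacobian remainder factor `AK(i,l) = ⟦jacExprS f K i l⟧(S) ∋ (DΦ_K(z) e_l)ᵢ` by the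
constant-folded code lists. [cite: WalawskaWilczak2016, §2.1 (C¹ high-order enclosure)]
[cite: Moore1979, §4.3 eq. (4.21)] -/
def varRemFactorS (i l : Fin n) : Iv :=
  (evalBox c.cfg (jacExprS c.field c.order i l) c.apriori).getD 0

/-- The Jacobian remainder matrix `NN = AK · VV`. [cite: WalawskaWilczak2016, §2.1 (C¹ high-order enclosure)]
[cite: Neumaier1991, §3.1 Proposition 3.1.2 (6)] -/
def varRemBoxS : Fin n → Fin n → Iv :=
  imatmulQ c.varRemFactorS c.varApriori

/-- Every constant-folded Jacobian code list answered: all `EVⱼ` (`j < K`) over `W`, `AK` over `S`.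
[cite: Moore1979, §3.4 (last paragraph)] -/
def varRunsS : Bool :=
  ((List.range c.order).all fun j => allEntriesS fun i l =>
      (evalBox c.cfg (jacExprS c.field j i l) c.init).isSome) &&
    allEntriesS fun i l => (evalBox c.cfg (jacExprS c.field c.order i l) c.apriori).isSome

/-- **The fast checker**: the state certificate accepts (`EStepCert.check`, unchanged), every
constant-folded Jacobian code list answers, and the `C¹` test
`∑_{j<K} [0,h]ʲ·EVⱼ + [0,h]^K·(AK·VV) ⊆ VV` holds in exact rational interval arithmetic.
[cite: WalawskaWilczak2016, §2.1 (C¹ high-order enclosure)] [cite: NedialkovJacksonPryce2001, §3 (HOE existence test)]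
[cite: Moore1979, §3.4 (note after eq. (3.19))] -/
def checkS : Bool :=
  c.toE.check && c.varRunsS &&
    matLE (hoeMatBoxQ (stepIv c.step) c.varCoeffBoxS c.varRemBoxS c.order) c.varApriori

/-- The **Jacobian end box** `J1 = ∑_{j<K} [h,h]ʲ·EVⱼ + [h,h]^K·(AK·VV) ∋ D_xφ(h, x)` of the fast test.
[cite: Zgliczynski2002C1Lohner, §3 (C¹-Lohner algorithm: the enclosure of ∂φ/∂x(h,[x]))]
[cite: WalawskaWilczak2016, §2 (step structure [x_k],[V_k] ↦ [x_{k+1}],[V_{k+1}])] -/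
def varEndBoxS : Fin n → Fin n → Iv :=
  hoeMatBoxQ (pure c.step) c.varCoeffBoxS c.varRemBoxS c.order

variable {c}

/-- What an accepted fast certificate establishes: the state certificate accepts, `0 < K`, `0 ≤ h`,
the real state HOE test, every folded Jacobian code list answered with `varCoeffBoxS` /
`varRemFactorS` its answers, and the real `C¹` test. [cite: WalawskaWilczak2016, §2.1 (C¹ high-order enclosure)]
[cite: Moore1979, §8.1 eq. (8.10)] -/
theorem checkS_spec (hc : c.checkS = true) :
    c.toE.check = true ∧ 0 < c.order ∧ (0 : ℝ) ≤ (c.step : ℝ) ∧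
      hoeBox ((stepIv c.step).ratCast ℝ) (fun j => castBox (c.toE.coeffBox j))
          (castBox c.toE.remBox) c.order ≤ castBox c.apriori ∧
      (∀ j < c.order, ∀ i l,
        evalBox c.cfg (jacExprS c.field j i l) c.init = some (c.varCoeffBoxS j i l)) ∧
      (∀ i l, evalBox c.cfg (jacExprS c.field c.order i l) c.apriori =
        some (c.varRemFactorS i l)) ∧
      hoeMatBox ((stepIv c.step).ratCast ℝ) (fun j => castMat (c.varCoeffBoxS j))
          (castMat c.varRemBoxS) c.order ≤ castMat c.varApriori := by
  simp only [checkS, Bool.and_eq_true] at hc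
  obtain ⟨⟨hE, hruns⟩, htestV⟩ := hc
  obtain ⟨hK, hh, -, -, -, htest⟩ := EStepCert.check_spec hE
  simp only [varRunsS, Bool.and_eq_true, List.all_eq_true, List.mem_range] at hruns
  obtain ⟨hrunW, hrunS⟩ := hruns
  refine ⟨hE, hK, hh, htest, fun j hj i l => ?_, fun i l => ?_, ?_⟩
  · have h := of_allEntriesS (hrunW j hj) i l
    obtain ⟨D, hD⟩ := Option.isSome_iff_exists.mp h
    rw [hD, varCoeffBoxS, hD, Option.getD_some]
  · have h := of_allEntriesS hrunS i l
    obtain ⟨D, hD⟩ := Option.isSome_iff_exists.mp h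
    rw [hD, varRemFactorS, hD, Option.getD_some]
  · have h := castMat_mono (le_of_matLE htestV)
    rw [castMat_hoeMatBoxQ] at h
    exact h

/-- The folded Jacobian coefficient matrices enclose `DΦⱼ` on `W` (`j < K`).
[cite: WalawskaWilczak2016, §2.1 (C¹ high-order enclosure)] [cite: Moore1979, §4.3 eq. (4.21)] -/
theorem varCoeffBoxS_mem (hc : c.checkS = true) {j : ℕ} (hj : j < c.order) {y : Fin n → ℝ}
    (hy : y ∈ boxSet (castBox c.init)) (i l : Fin n) :
    smoothTaylorFDeriv (contDiffOn_fieldFun c.field) j y (Pi.single l 1) i ∈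
      castMat (c.varCoeffBoxS j) i l := by
  obtain ⟨hE, -, -, -, hEV, -, -⟩ := checkS_spec hc
  rw [castMat_apply]
  exact smoothTaylorFDeriv_mem_evalBoxS (EStepCert.init_subset_dom hE) (hEV j hj i l) hy

/-- The folded Jacobian remainder factor encloses `DΦ_K` on `S`.
[cite: WalawskaWilczak2016, §2.1 (C¹ high-order enclosure)] [cite: Moore1979, §4.3 eq. (4.21)] -/
theorem varRemFactorS_mem (hc : c.checkS = true) {z : Fin n → ℝ}
    (hz : z ∈ boxSet (castBox c.apriori)) (i l : Fin n) :
    smoothTaylorFDeriv (contDiffOn_fieldFun c.field) c.order z (Pi.single l 1) i ∈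
      castMat c.varRemFactorS i l := by
  obtain ⟨hE, -, -, -, -, hAK, -⟩ := checkS_spec hc
  rw [castMat_apply]
  exact smoothTaylorFDeriv_mem_evalBoxS (EStepCert.apriori_subset_dom hE) (hAK i l) hz

/-- `castMat varEndBoxS` is the real matrix HOE box at the point interval `[h, h]`.
[cite: WalawskaWilczak2016, §2 (step structure [x_k],[V_k] ↦ [x_{k+1}],[V_{k+1}])] -/
theorem castMat_varEndBoxS :
    castMat c.varEndBoxS =
      hoeMatBox (pure (c.step : ℝ)) (fun j => castMat (c.varCoeffBoxS j)) (castMat c.varRemBoxS)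
        c.order := by
  rw [varEndBoxS, castMat_hoeMatBoxQ, ratCast_pure]

/-- **The derivative of the flow from an accepted fast certificate** (Walawska–Wilczak 2016 §1.2,
§2.2 Lemma 2; Zgliczyński 2002): under `checkS` and `posBox S`, for any family `u` of solutions on
`[0, h]` from the points of `W` staying in `S`, every `x ∈ W` and `τ ∈ [0, h]`, the flow map
`x' ↦ u x' τ` has within `W` at `x` a derivative `J` with entries in `VV` and in
`∑_{j<K} [τ,τ]ʲ·EVⱼ + [τ,τ]^K·(AK·VV)`. [cite: WalawskaWilczak2016, §1.2 (ψ = D_xφ·V) and §2.2 Lemma 2]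
[cite: Zgliczynski2002C1Lohner, §3 (C¹-Lohner algorithm: the enclosure of ∂φ/∂x(h,[x]))] -/
theorem hasFDerivWithinAt_flowS (hc : c.checkS = true) (hS : posBox c.apriori = true)
    {u : (Fin n → ℝ) → ℝ → Fin n → ℝ}
    (hu : IsSolutionFamily (fieldFun c.field) (boxSet (castBox c.apriori))
      (boxSet (castBox c.init)) (c.step : ℝ) u)
    {x : Fin n → ℝ} (hx : x ∈ boxSet (castBox c.init)) {τ : ℝ} (hτ : τ ∈ Icc 0 (c.step : ℝ)) :
    ∃ J : (Fin n → ℝ) →L[ℝ] (Fin n → ℝ),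
      HasFDerivWithinAt (fun x' => u x' τ) J (boxSet (castBox c.init)) x ∧
      (∀ i l, J (Pi.single l 1) i ∈ castMat c.varApriori i l) ∧
      (∀ i l, J (Pi.single l 1) i ∈
        hoeMatBox (pure τ) (fun j => castMat (c.varCoeffBoxS j)) (castMat c.varRemBoxS)
          c.order i l) ∧
      ∃ N : (Fin n → ℝ) →L[ℝ] (Fin n → ℝ),
        (∀ i l, N (Pi.single l 1) i ∈ castMat c.varRemBoxS i l) ∧
        J = (∑ j ∈ Finset.range c.order,
            τ ^ j • smoothTaylorFDeriv (contDiffOn_fieldFun c.field) j x) + τ ^ c.order • N := by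
  obtain ⟨hE, hK, hh, htest, -, -, htestV⟩ := checkS_spec hc
  exact hasFDerivWithinAt_flow_intervalTest_smoothOn_local (contDiffOn_fieldFun c.field) hK hh
    (fun t ht => mem_ratCast_stepIv ht) (castBox c.init) (castBox c.apriori) (castBox c.toE.remBox)
    (fun j => castBox (c.toE.coeffBox j)) (fun j => castMat (c.varCoeffBoxS j))
    (castMat c.varRemFactorS) (castMat c.varApriori) (castMat c.varRemBoxS)
    (EStepCert.apriori_subset_dom hE) (uniqueDiffOn_of_posBox hS)
    (fun j hj => EStepCert.mapsTo_coeffBox hE hj) (EStepCert.mapsTo_remBox hE) htest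
    (fun j hj y hy i l => varCoeffBoxS_mem hc hj hy i l)
    (fun z hz i l => varRemFactorS_mem hc hz i l)
    (castMat_imatmulQ _ _).symm.le htestV hu hx hτ (T' := pure τ) (mem_pure_self τ)

/-- **`D_xφ(h, [W]) ⊆ J1`** for the fast test: the flow map at time `h` has within `W` at every
`x ∈ W` a derivative with entries in `varEndBoxS`.
[cite: Zgliczynski2002C1Lohner, §3 (C¹-Lohner algorithm: the enclosure of ∂φ/∂x(h,[x]))]
[cite: WalawskaWilczak2016, §2.2 Lemma 2] -/
theorem hasFDerivWithinAt_flow_stepS (hc : c.checkS = true) (hS : posBox c.apriori = true)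
    {u : (Fin n → ℝ) → ℝ → Fin n → ℝ}
    (hu : IsSolutionFamily (fieldFun c.field) (boxSet (castBox c.apriori))
      (boxSet (castBox c.init)) (c.step : ℝ) u)
    {x : Fin n → ℝ} (hx : x ∈ boxSet (castBox c.init)) :
    ∃ J : (Fin n → ℝ) →L[ℝ] (Fin n → ℝ),
      HasFDerivWithinAt (fun x' => u x' c.step) J (boxSet (castBox c.init)) x ∧
      ∀ i l, J (Pi.single l 1) i ∈ castMat c.varEndBoxS i l := by
  obtain ⟨-, -, hh, -, -, -, -⟩ := checkS_spec hc
  obtain ⟨J, hJ, -, hJ1, -⟩ := hasFDerivWithinAt_flowS hc hS hu hx (τ := (c.step : ℝ)) ⟨hh, le_rfl⟩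
  refine ⟨J, hJ, ?_⟩
  rw [castMat_varEndBoxS]
  exact hJ1

end EVarStepCert

end Literature.Analysis.ODE
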